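import Literature.MathematicalPhysics.QuantumFieldTheory.Balaban1983to89.B9Eq334GaugeCovarianceZdHerm

/-!
# `Balaban1983to89.B9Eq336PureGaugeOrbitZd` — [Balaban1985BackgroundPropagators] (3.34)–(3.36) p. 396 AT THE `ℤᵈ × 𝔸` CARRIER: the gauge action
# `U₀ ↦ U₀^w` is a HOMEOMORPHISM of the background space (product topology), so every property of `Δ_a(U₀)` that holds NEAR a background `U₁` WITHIN a
# gauge-invariant set `𝒰` and is an ORBIT property holds near `U₁^w` within `𝒰` — in particular positive-definiteness of the genuine `Δ_a` on `E_𝔤(Ω₀)` near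
# EVERY PURE GAUGE `1^w` once it holds near `U₀ = 1` (the glue between the (ii) openness engine and the (iii) covariance files of the per-member Theorem-3.11 road)

statement-level skeleton of published theorems with citation tags; proofs where landed; nothing here is a claim about the
Yang–Mills mass gap

T. Bałaban, *Propagators for lattice gauge theories in a background field*, Commun. Math. Phys. **99** (1985) 389–434 [`Balaban1985BackgroundPropagators`,
"B9"], journal page = PDF page + 388.  THE PRINT (verbatim).  p. 396: *«Δ_a(U^u) = R(u)Δ_a(U)R(u⁻¹), G(U^u) = R(u)G(U)R(u⁻¹). (3.34) … there exists a gauge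
transformation u defined on □ … such that U^u = e^{iηA} and |A| < O(1)Mα₀ (3.36)»* — the regularity class is a neighbourhood of the pure-gauge orbit, cube
by cube; p. 416 Theorem 3.11 (positivity of `Δ_a`, `G` on the class).

CITATION HEADER ∕ WHY THIS FILE (cell `pub-ymgap`, HUMAN RULING D-0062 ∕ D-0149; width seat `pub-ymgap-dag-n06-w3` (g3), node N06 = [B9]; CLAIM-2 FILE E).  The
per-member Theorem-3.11 road at the `ℤᵈ` carrier: (i) dag-n06-b `flat_posDef_herm_cube` (positivity at `U₀ = 1`), (ii) dag-n06-w4 g3 `B9Thm311PosDefOpenZd`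
(`bondPair_pos_eventually…`: positivity `∀ᶠ U₀ in 𝓝[𝒰] 1`), (iii) this seat's `B9Eq334GaugeCovarianceZd(Herm)` (positivity passes `U₀ ↦ U₀^w`).  THIS FILE is the
topological half of (iii): `gaugeAct w` is a homeomorphism with inverse `gaugeAct w⁻¹`, so «eventually within `𝒰` at `U₁`» transports to «eventually within `𝒰` at
`U₁^w`» for every orbit property on a `w`-invariant `𝒰`.  INPUTS BY NAME: Mathlib (`Homeomorph`, `nhdsWithin`), the companions' `gaugeAct_inv_gaugeAct`,
`posDef(H)_gaugeAct`, `letterCovAt_deltaAOf_opsAllZd(_of_reg17Univ)`, `inv_mem_unitaryUnits`.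

WHAT IS DECLARED ∕ PROVED (kernel, 0 sorry; one definition with body — the homeomorphism — and theorems; no `instance`, no `notation`).
* §1 `continuous_gaugeAct` (`U₀ ↦ U₀^w` is continuous, product topology on `ℤᵈ × {directions} → 𝔸ˣ`), ★ `gaugeHomeo w` (def: the homeomorphism `U₀ ↦ U₀^w`,
  inverse `U₀ ↦ U₀^{w⁻¹}`), `gaugeHomeo_apply ∕ gaugeHomeo_symm_apply`.
* §2 ★★ `eventually_nhdsWithin_gaugeAct` — for a `w`-invariant set `𝒰` and a predicate `P` with `P U₀ → P (U₀^w)` on `𝒰`: `(∀ᶠ U₀ in 𝓝[𝒰] U₁, P U₀) →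
  ∀ᶠ U₀ in 𝓝[𝒰] U₁^w, P U₀`.
* §3 for ANY record whose `Δ_a` is covariant on `𝒰`: ★★ `posDefH_eventually_gaugeAct` ∕ `posDef_eventually_gaugeAct` (positivity on `E_𝔤(Ω₀)` ∕ `E(Ω₀)` eventually
  within `𝒰` at `U₁` ⟹ at `U₁^w`).
* §4 the genuine record `opsAllZd`: ★★★ `posDefH_opsAllZd_eventually_gaugeAct` (box-clause classes) and ★★★ `posDefH_opsAllZd_eventually_gaugeAct_of_reg17Univ` (`𝒰`
  inside the class (1.7) on `ℤᵈ`, ANY class incl. `cubeLamBP` — the exact currency of `B9Thm311PosDefOpenZd.bondPair_pos_eventually_one_cube`).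

HONEST SCOPE.  Point-set topology + the companions' conjugation identities; no estimate of [B9]; Theorem 3.11 at curved `U₀` NOT proved (a neighbourhood of the
pure-gauge orbit is not yet print's class (3.35) with a uniform `α₀′` — that is the compactness ∕ smallness step of the road); count-neutral; N05 ∕ N06 NOT
discharged; K1⁷ `stmt-QuantumFields-20542` NOT closed; one finite `𝕋⁴` programme at fixed `ε`, Bałaban as printed; R4 closes only the conditional finite-`𝕋⁴` rung
`BalabanLadder.UV` — nothing continuum ∕ ℝ⁴ ∕ OS ∕ mass gap ∕ Clay.  Unit `pub-ymgap-dag-n06-w3` (g3), 2026-08-28.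
-/

noncomputable section

namespace Literature.MathematicalPhysics.QuantumFieldTheory.Balaban1983to89.B9Eq336PureGaugeOrbitZd

open B7Prop1Explicit B7Eq78Linearization
open B7Prop1Local (InBox loK bondHiK)
open B7Prop2Explicit (unitaryUnits)
open B8LeafModelZd (ZdIdx)
open B9SupplySockB9P3ZdLetters (OpsZd deltaAOf)
open B9Eq327GreenZd (domSub bondPair)
open B9Eq327GreenZdHerm (domSubH)
open B9SupplySockB9P3ZdAllLettersZd (opsAllZd)
open B9Eq333ProjectionCovarianceZd (inv_mem_unitaryUnits gaugeAct_inv_gaugeAct)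
open B9Eq334GaugeCovarianceZd (LetterCovAt posDef_gaugeAct letterCovAt_deltaAOf_opsAllZd letterCovAt_deltaAOf_opsAllZd_of_reg17Univ)
open B9Eq334GaugeCovarianceZdHerm (posDefH_gaugeAct)
open Filter Topology

-- `Site` alone could resolve to the torus sites of `Setup.lean`; re-export the `ℤ^d` sites of `B7Prop1Explicit`.
export B7Prop1Explicit (Site)

variable {d : ℕ} {𝔸 : Type*} [CStarAlgebra 𝔸]

/-! ## §1  `U₀ ↦ U₀^w` is a homeomorphism of the background space -/

section Homeo

variable (w : Site d → 𝔸ˣ)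

omit [CStarAlgebra 𝔸] in
/-- **`U₀ ↦ U₀^w` IS CONTINUOUS** in the product topology (each bond variable `w(x)U₀(x, x+e_μ)w(x+e_μ)⁻¹` depends continuously on one coordinate).
[cite: Balaban1985BackgroundPropagators, (3.28) p.395; Balaban1985Averaging, (8) p.18] -/
theorem continuous_gaugeAct {𝔸 : Type*} [NormedRing 𝔸] (w : Site d → 𝔸ˣ) :
    Continuous fun U₀ : Site d → Fin d → 𝔸ˣ => gaugeAct w U₀ := by
  refine continuous_pi fun x => continuous_pi fun μ => ?_
  show Continuous fun U₀ : Site d → Fin d → 𝔸ˣ => w x * U₀ x μ * (w (x + e μ))⁻¹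
  have h1 : Continuous fun U₀ : Site d → Fin d → 𝔸ˣ => U₀ x μ := (continuous_apply μ).comp (continuous_apply x)
  exact (continuous_const.mul h1).mul continuous_const

omit [CStarAlgebra 𝔸] in
/-- ★ **THE GAUGE ACTION AS A HOMEOMORPHISM** `U₀ ↦ U₀^w`, inverse `U₀ ↦ U₀^{w⁻¹}`. [cite: Balaban1985BackgroundPropagators, (3.28) p.395; Balaban1985Averaging, (8) p.18] -/
def gaugeHomeo {𝔸 : Type*} [NormedRing 𝔸] (w : Site d → 𝔸ˣ) : (Site d → Fin d → 𝔸ˣ) ≃ₜ (Site d → Fin d → 𝔸ˣ) where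
  toFun U₀ := gaugeAct w U₀
  invFun U₀ := gaugeAct w⁻¹ U₀
  left_inv U₀ := gaugeAct_inv_gaugeAct w U₀
  right_inv U₀ := by
    have h := gaugeAct_inv_gaugeAct w⁻¹ U₀
    rwa [inv_inv] at h
  continuous_toFun := continuous_gaugeAct w
  continuous_invFun := continuous_gaugeAct w⁻¹

omit [CStarAlgebra 𝔸] in
/-- the homeomorphism, unfolded. [cite: Balaban1985BackgroundPropagators, (3.28) p.395 (bookkeeping)] -/
theorem gaugeHomeo_apply {𝔸 : Type*} [NormedRing 𝔸] (w : Site d → 𝔸ˣ) (U₀ : Site d → Fin d → 𝔸ˣ) : gaugeHomeo w U₀ = gaugeAct w U₀ := rfl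

omit [CStarAlgebra 𝔸] in
/-- its inverse, unfolded. [cite: Balaban1985BackgroundPropagators, (3.28) p.395 (bookkeeping)] -/
theorem gaugeHomeo_symm_apply {𝔸 : Type*} [NormedRing 𝔸] (w : Site d → 𝔸ˣ) (U₀ : Site d → Fin d → 𝔸ˣ) :
    (gaugeHomeo w).symm U₀ = gaugeAct w⁻¹ U₀ := rfl

end Homeo

/-! ## §2  «eventually within a gauge-invariant set» transports along the orbit -/

section Transport

omit [CStarAlgebra 𝔸] in
/-- ★★ **ORBIT PROPERTIES THAT HOLD NEAR `U₁` WITHIN A GAUGE-INVARIANT `𝒰` HOLD NEAR `U₁^w` WITHIN `𝒰`**: `gaugeAct w` maps `𝓝[𝒰] U₁` onto `𝓝[𝒰] U₁^w` (a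
homeomorphism preserving `𝒰`), and `P` passes `U₀ ↦ U₀^w` on `𝒰`. [cite: Balaban1985BackgroundPropagators, (3.34)–(3.36) p.396] -/
theorem eventually_nhdsWithin_gaugeAct {𝔸 : Type*} [NormedRing 𝔸] (w : Site d → 𝔸ˣ) {𝒰 : Set (Site d → Fin d → 𝔸ˣ)}
    (h𝒰 : ∀ U₀ ∈ 𝒰, gaugeAct w U₀ ∈ 𝒰) (h𝒰' : ∀ U₀ ∈ 𝒰, gaugeAct w⁻¹ U₀ ∈ 𝒰) {P : (Site d → Fin d → 𝔸ˣ) → Prop}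
    (hP : ∀ U₀ ∈ 𝒰, P U₀ → P (gaugeAct w U₀)) {U₁ : Site d → Fin d → 𝔸ˣ} (h : ∀ᶠ U₀ in 𝓝[𝒰] U₁, P U₀) :
    ∀ᶠ U₀ in 𝓝[𝒰] (gaugeAct w U₁), P U₀ := by
  -- `𝒰` is invariant under the homeomorphism, so `𝓝[𝒰] (U₁^w)` is the image of `𝓝[𝒰] U₁`
  have himage : (gaugeHomeo w) '' 𝒰 = 𝒰 := by
    ext U₀
    constructor
    · rintro ⟨V, hV, rfl⟩
      exact h𝒰 V hV
    · intro hU₀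
      refine ⟨gaugeAct w⁻¹ U₀, h𝒰' U₀ hU₀, ?_⟩
      show gaugeAct w (gaugeAct w⁻¹ U₀) = U₀
      have h1 := gaugeAct_inv_gaugeAct w⁻¹ U₀
      rwa [inv_inv] at h1
  have hmap : map (gaugeHomeo w) (𝓝[𝒰] U₁) = 𝓝[𝒰] (gaugeAct w U₁) := by
    rw [(gaugeHomeo w).isEmbedding.map_nhdsWithin_eq, himage]
    rfl
  rw [← hmap, eventually_map]
  -- on `𝓝[𝒰] U₁` the points lie in `𝒰` eventually, where `P` transports
  filter_upwards [h, eventually_mem_nhdsWithin] with U₀ hU₀ hmem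
  exact hP U₀ hmem hU₀

end Transport

/-! ## §3  Positive-definiteness of `Δ_a` near every point of the orbit -/

section PosDef

variable (τ : 𝔸 →ₗ[ℂ] ℂ) (η : ℝ) (o : OpsZd d 𝔸) (Ω₀ : Set (Site d)) {w : Site d → 𝔸ˣ} {𝒰 : Set (Site d → Fin d → 𝔸ˣ)} {U₁ : Site d → Fin d → 𝔸ˣ}

/-- ★★ **FOR ANY RECORD WHOSE `Δ_a` IS COVARIANT ON `𝒰`**: positivity of `⟨A, Δ_a(U₀)A⟩_τ` on `E_𝔤(Ω₀)` eventually within `𝒰` at `U₁` ⟹ eventually within `𝒰`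
at `U₁^w` (`τ` tracial, `w` unitary, `𝒰` invariant under `w` and `w⁻¹`). [cite: Balaban1985BackgroundPropagators, Thm 3.11 p.416, (3.34)–(3.36) p.396] -/
theorem posDefH_eventually_gaugeAct (hτt : ∀ a b : 𝔸, τ (a * b) = τ (b * a)) (hw : ∀ z, w z ∈ unitaryUnits 𝔸)
    (h𝒰 : ∀ U₀ ∈ 𝒰, gaugeAct w U₀ ∈ 𝒰) (h𝒰' : ∀ U₀ ∈ 𝒰, gaugeAct w⁻¹ U₀ ∈ 𝒰) (hcov : ∀ U₀ ∈ 𝒰, LetterCovAt (deltaAOf η o) U₀ w)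
    (h : ∀ᶠ U₀ in 𝓝[𝒰] U₁, ∀ A ∈ domSubH (𝔸 := 𝔸) Ω₀, A ≠ 0 → 0 < bondPair τ A (deltaAOf η o U₀ A)) :
    ∀ᶠ U₀ in 𝓝[𝒰] (gaugeAct w U₁), ∀ A ∈ domSubH (𝔸 := 𝔸) Ω₀, A ≠ 0 → 0 < bondPair τ A (deltaAOf η o U₀ A) :=
  eventually_nhdsWithin_gaugeAct w h𝒰 h𝒰' (fun U₀ hU₀ hpos => posDefH_gaugeAct η o Ω₀ τ hτt hw (hcov U₀ hU₀) hpos) h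

/-- ★★ **THE `E(Ω₀)` TWIN**. [cite: Balaban1985BackgroundPropagators, Thm 3.11 p.416, (3.34)–(3.36) p.396] -/
theorem posDef_eventually_gaugeAct (hτt : ∀ a b : 𝔸, τ (a * b) = τ (b * a)) (hw : ∀ z, w z ∈ unitaryUnits 𝔸)
    (h𝒰 : ∀ U₀ ∈ 𝒰, gaugeAct w U₀ ∈ 𝒰) (h𝒰' : ∀ U₀ ∈ 𝒰, gaugeAct w⁻¹ U₀ ∈ 𝒰) (hcov : ∀ U₀ ∈ 𝒰, LetterCovAt (deltaAOf η o) U₀ w)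
    (h : ∀ᶠ U₀ in 𝓝[𝒰] U₁, ∀ A ∈ domSub (𝔸 := 𝔸) Ω₀, A ≠ 0 → 0 < bondPair τ A (deltaAOf η o U₀ A)) :
    ∀ᶠ U₀ in 𝓝[𝒰] (gaugeAct w U₁), ∀ A ∈ domSub (𝔸 := 𝔸) Ω₀, A ≠ 0 → 0 < bondPair τ A (deltaAOf η o U₀ A) :=
  eventually_nhdsWithin_gaugeAct w h𝒰 h𝒰' (fun U₀ hU₀ hpos => posDef_gaugeAct η o Ω₀ τ hτt hw (hcov U₀ hU₀) hpos) h

end PosDef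

/-! ## §4  The genuine four-letter record: near `U₁` within `𝒰` ⟹ near `U₁^w` within `𝒰` -/

section Record

variable [FiniteDimensional ℝ 𝔸] [Nontrivial 𝔸] (τ : 𝔸 →ₗ[ℂ] ℂ) (L : ℕ) (ΛbP : ℕ → ℕ → Set (Site d × Fin d))
  (ops₀ : ℝ → ZdIdx d L → ℕ → OpsZd d 𝔸) (M : ℝ) (i : ZdIdx d L) (m : ℕ) {w : Site d → 𝔸ˣ} {𝒰 : Set (Site d → Fin d → 𝔸ˣ)} {U₁ : Site d → Fin d → 𝔸ˣ}
  (hL : 2 ≤ L) (hτt : ∀ a b : 𝔸, τ (a * b) = τ (b * a)) (hτs : ∀ a : 𝔸, τ (star a) = starRingEnd ℂ (τ a)) (hτp : ∀ a : 𝔸, a ≠ 0 → 0 < (τ (star a * a)).re)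
  (hw : ∀ z, w z ∈ unitaryUnits 𝔸) (hΩ : (i.Ω 0).Finite)
  (h𝒰u : ∀ U₀ ∈ 𝒰, ∀ x κ, U₀ x κ ∈ unitaryUnits 𝔸) (h𝒰 : ∀ U₀ ∈ 𝒰, gaugeAct w U₀ ∈ 𝒰) (h𝒰' : ∀ U₀ ∈ 𝒰, gaugeAct w⁻¹ U₀ ∈ 𝒰)
include hL hτt hτs hτp hw hΩ h𝒰u h𝒰 h𝒰'

/-- ★★★ **POSITIVITY OF THE GENUINE `Δ_a` ON `E_𝔤(Ω₀)` NEAR `U₁` WITHIN `𝒰` ⟹ NEAR `U₁^w` WITHIN `𝒰`**, box-clause classes: `𝒰` any `w^{±1}`-invariant set of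
unitary backgrounds, `w` unitary. [cite: Balaban1985BackgroundPropagators, Thm 3.11 p.416, (3.34)–(3.36) p.396] -/
theorem posDefH_opsAllZd_eventually_gaugeAct (hbox : ∀ j, 1 ≤ j → j ≤ m → ∀ c ∈ ΛbP m j, ∀ x, InBox (loK L j c.1) (bondHiK L j c.1 c.2) x → x ∈ i.Ω (j - 1))
    (h : ∀ᶠ U₀ in 𝓝[𝒰] U₁, ∀ A ∈ domSubH (𝔸 := 𝔸) (i.Ω 0), A ≠ 0 → 0 < bondPair τ A (deltaAOf i.η (opsAllZd τ L ΛbP ops₀ M i m) U₀ A)) :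
    ∀ᶠ U₀ in 𝓝[𝒰] (gaugeAct w U₁), ∀ A ∈ domSubH (𝔸 := 𝔸) (i.Ω 0), A ≠ 0 → 0 < bondPair τ A (deltaAOf i.η (opsAllZd τ L ΛbP ops₀ M i m) U₀ A) :=
  posDefH_eventually_gaugeAct τ i.η _ (i.Ω 0) hτt hw h𝒰 h𝒰'
    (fun U₀ hU₀ => letterCovAt_deltaAOf_opsAllZd τ L ΛbP ops₀ M i m hL hbox hτt hτs hτp (h𝒰u U₀ hU₀) hw hΩ) h

/-- ★★★ **THE SAME FOR `𝒰` INSIDE THE CLASS (1.7) ON ALL OF `ℤᵈ`** (window `α_Q∕L²`; NO box clause — ANY averaging class, crossing bonds allowed: the regime set of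
`B9Thm311PosDefOpenZd.bondPair_pos_eventually_one_cube`, class `cubeLamBP`, which is gauge invariant by `reg17_gaugeAct_iff` and contains `1`): with the flat
positivity (dag-n06-b) and the openness at `U₁ = 1` (dag-n06-w4 g3), positivity of the genuine `Δ_a` on `E_𝔤(□₀)` holds within `𝒰` near EVERY PURE GAUGE `1^w`.
[cite: Balaban1985BackgroundPropagators, Thm 3.11 p.416, (3.34)–(3.36) p.396; Balaban1985RegularSpaces, (1.7) p.77] -/
theorem posDefH_opsAllZd_eventually_gaugeAct_of_reg17Univ
    (h𝒰r : ∀ U₀ ∈ 𝒰, B9Eq316AveragingTransposeZd.Reg17 L m (fun _ => (Set.univ : Set (Site d))) (B9Eq316AveragingTransposeZd.alphaQ d L / (L : ℝ) ^ 2) U₀)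
    (h : ∀ᶠ U₀ in 𝓝[𝒰] U₁, ∀ A ∈ domSubH (𝔸 := 𝔸) (i.Ω 0), A ≠ 0 → 0 < bondPair τ A (deltaAOf i.η (opsAllZd τ L ΛbP ops₀ M i m) U₀ A)) :
    ∀ᶠ U₀ in 𝓝[𝒰] (gaugeAct w U₁), ∀ A ∈ domSubH (𝔸 := 𝔸) (i.Ω 0), A ≠ 0 → 0 < bondPair τ A (deltaAOf i.η (opsAllZd τ L ΛbP ops₀ M i m) U₀ A) :=
  posDefH_eventually_gaugeAct τ i.η _ (i.Ω 0) hτt hw h𝒰 h𝒰'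
    (fun U₀ hU₀ => letterCovAt_deltaAOf_opsAllZd_of_reg17Univ τ L ΛbP ops₀ M i m hL hτt hτs hτp (h𝒰u U₀ hU₀) (h𝒰r U₀ hU₀) hw hΩ) h

end Record

end Literature.MathematicalPhysics.QuantumFieldTheory.Balaban1983to89.B9Eq336PureGaugeOrbitZd

end
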